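import Summits.QuantumFields.BalabanUV.T4Continuum.Support.ShellMeasureAverageProp3Remainder
import Literature.MathematicalPhysics.QuantumFieldTheory.Balaban1983to89.B7Prop3GeneralLinear

/-!
# [B7] Proposition 3 at a general background: the polydisc chart `|A_b| < c₃(d, L)` — analyticity, the Fréchet
# derivative is «L(Q(V₀)A)_c», and the Landau correction as the second-order remainder of an analytic chart map

Row S55 (analytic∕remainder half) of the pub-balaban NE7c crew table — the clause "Q(V₀, A, c) […] is an analytic function
of A […] for |A_b| < c₃(d, L)" of [Balaban1985Averaging] Prop. 3 p. 36 in CHART form: the bond variables on a finite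
bond set `S` are coordinates `a ∈ 𝔸^S` (sup norm; b07's insertion `B7Prop3Flat.insCfg S a`, the pattern of
`B7Prop3Flat.prop3_flat_analyticOnNhd_ins` at `V₀ = 1`), and on the polydisc `‖a‖ < c₃(d, L)`:

* `analyticOnNhd_chart` — `a ↦ Q(V₀, insCfg S a, c)` (`= B7Prop3GeneralLinear.Qcov L V₀ (insCfg S a) q κ`) is analytic on
  `ball 0 (c₃(d,L))` (the Literature file's parametrised `prop3_general_analyticAt_of_le_c3` with `B := insCfg S`);
  `differentiableOn_chart` — hence complex-differentiable there (the `hCd`-type shape); `chart_zero`; `norm_chart_le` (`≤ 4`).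
* `fderiv_chart_zero_apply` — THE FRÉCHET DERIVATIVE AT `0` IS «L(Q(V₀)A)_c»: `D(chart)(0) v = linQcov L V₀ (insCfg S v) q κ`
  (chain rule along the line `s ↦ s • v` + `insCfg_smul`).
* `norm_nonlin_chart_le` — the Landau correction `C(V₀, insCfg S a, c) = chart a − D(chart)(0) a` (row D4's `nonlin`) obeys
  `‖·‖ ≤ (8 / c₃(d,L)²)·‖a‖²` on the polydisc (the `hCq`-type shape; several-variable Cauchy estimate
  `LinearizingChange267FromQ.nonlin_sq_bound` with the sup bound `4`), and `nonlin_chart_eq_Ccov` identifies it with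
  `B7Prop3GeneralLinear.Ccov L V₀ (insCfg S a) q κ`.

DISPLAYED BINDERS (honest): `V₀` unit-bounded (`∈ U1`) with `α`-regular block contours at `c` (`α ≤ 1/64`), `1 ≤ L`, any
finite `S`.  «NE7c ⇐ the named binders»; NE7c is NOT printed and NOT proved here; one clause of one printed proposition.

HONEST FRAMING (cell, verbatim): rung (B)+1 on a FINITE `T⁴` — NOT infinite volume, NOT mass gap, NOT Clay; NE7c NOT
PRINTED, NOT PROVED; spine PROVED 0/9.  HONEST DEPENDENCY: continuum YM on T⁴ ⇐ BetaPertH ∧ nine spine estimates (0/9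
proved); BetaPertH ⇐ (D1) ∧ (D4) ∧ CAP+tail; G-an2-4 gates asym, D1 and NE2/3/4.

v1.1 (DOCFIX, module docstring only; declarations byte-identical): the cell's HONEST sentences added (XREAD C-ne7cleaf09-39).
-/

noncomputable section

open scoped BigOperators
open NormedSpace Metric

namespace Summit.QuantumFields.BalabanUV.T4Continuum.ShellMeasureAverageProp3Chart

open Literature.MathematicalPhysics.QuantumFieldTheory.Balaban1983to89
open B7Prop1Explicit B7Prop3Flat B7Eq92Concrete MatrixLog B7Prop3GeneralAnalytic B7Prop3GeneralLinear
open Summit.QuantumFields.BalabanUV.Beta.LinearizingChange267FromQ (nonlin nonlin_sq_bound apply_eq_lin_add_nonlin)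
open ShellMeasureAverageProp3Remainder (theta_le_of_le_c3 mlog_dbavgCov_expCfg_zero)

variable {d : ℕ}
variable {𝔸 : Type*} [NormedRing 𝔸] [NormedAlgebra ℂ 𝔸] [CompleteSpace 𝔸] [NormOneClass 𝔸]

/-- **PROP. 3 (121) ON THE POLYDISC**: for a finite bond set `S`, `a ↦ Q(V₀, insCfg S a, c)` is analytic on `‖a‖ < c₃(d, L)`
(sup norm on `𝔸^S`). [cite: Balaban1985Averaging, Proposition 3 (121) p.36] -/
theorem analyticOnNhd_chart (S : Finset (B7Prop1Explicit.Site d × Fin d)) {L : ℕ} (hL : 1 ≤ L)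
    {V₀ : B7Prop1Explicit.Site d → Fin d → 𝔸ˣ} (hV₀ : ∀ x κ, V₀ x κ ∈ U1 𝔸) {α : ℝ}
    (q : B7Prop1Explicit.Site d) (κ : Fin d) (hα1 : α ≤ 1 / 64)
    (hreg : ∀ r : Fin d → Fin L, ‖((Wcx L V₀ q κ (boxVec L r) : 𝔸ˣ) : 𝔸) - 1‖ ≤ α) :
    AnalyticOnNhd ℂ (fun a : S → 𝔸 => Qcov L V₀ (insCfg S a) q κ) (ball 0 (c3 d L)) := fun a₀ ha₀ =>
  prop3_general_analyticAt_of_le_c3 (insCfg S) (fun x κ' => analyticAt_insCfg S x κ' a₀) hL hV₀ (norm_nonneg a₀)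
    (fun x κ' => norm_insCfg_le S a₀ x κ') (mem_ball_zero_iff.1 ha₀).le q κ hα1 hreg

/-- … hence complex-differentiable on the polydisc (the shape END-II-type consumers take). [folklore] -/
theorem differentiableOn_chart (S : Finset (B7Prop1Explicit.Site d × Fin d)) {L : ℕ} (hL : 1 ≤ L)
    {V₀ : B7Prop1Explicit.Site d → Fin d → 𝔸ˣ} (hV₀ : ∀ x κ, V₀ x κ ∈ U1 𝔸) {α : ℝ}
    (q : B7Prop1Explicit.Site d) (κ : Fin d) (hα1 : α ≤ 1 / 64)
    (hreg : ∀ r : Fin d → Fin L, ‖((Wcx L V₀ q κ (boxVec L r) : 𝔸ˣ) : 𝔸) - 1‖ ≤ α) :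
    DifferentiableOn ℂ (fun a : S → 𝔸 => Qcov L V₀ (insCfg S a) q κ) (ball 0 (c3 d L)) :=
  (analyticOnNhd_chart S hL hV₀ q κ hα1 hreg).differentiableOn

omit [NormOneClass 𝔸] in
/-- `Q(V₀, insCfg S 0, c) = 0`. [folklore] -/
theorem chart_zero (S : Finset (B7Prop1Explicit.Site d × Fin d)) (L : ℕ) (V₀ : B7Prop1Explicit.Site d → Fin d → 𝔸ˣ)
    (q : B7Prop1Explicit.Site d) (κ : Fin d) : Qcov L V₀ (insCfg S (0 : S → 𝔸)) q κ = 0 := by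
  rw [insCfg_zero]; exact mlog_dbavgCov_expCfg_zero L V₀ q κ

/-- `‖Q(V₀, insCfg S a, c)‖ ≤ 4` on the polydisc. [folklore] -/
theorem norm_chart_le (S : Finset (B7Prop1Explicit.Site d × Fin d)) {L : ℕ} (hL : 1 ≤ L)
    {V₀ : B7Prop1Explicit.Site d → Fin d → 𝔸ˣ} (hV₀ : ∀ x κ, V₀ x κ ∈ U1 𝔸) {α : ℝ}
    (q : B7Prop1Explicit.Site d) (κ : Fin d) (hα1 : α ≤ 1 / 64)
    (hreg : ∀ r : Fin d → Fin L, ‖((Wcx L V₀ q κ (boxVec L r) : 𝔸ˣ) : 𝔸) - 1‖ ≤ α) :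
    ∀ a ∈ ball (0 : S → 𝔸) (c3 d L), ‖Qcov L V₀ (insCfg S a) q κ‖ ≤ 4 := fun a ha =>
  norm_mlog_dbavgCov_le hL hV₀ (insCfg S a) (a := ‖a‖) (norm_nonneg a) (fun x κ' => norm_insCfg_le S a x κ')
    le_rfl (by positivity) (theta_le_of_le_c3 hL (mem_ball_zero_iff.1 ha).le) q κ hα1 hreg

/-- **THE FRÉCHET DERIVATIVE OF THE CHART AT `0` IS «L(Q(V₀)A)_c»**: `D(a ↦ Q(V₀, insCfg S a, c))(0) v
= linQcov L V₀ (insCfg S v) q κ` — the chain rule along `s ↦ s • v` and the linearity of the insertion.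
[cite: Balaban1985Averaging, Proposition 3 (122) p.36] -/
theorem fderiv_chart_zero_apply (S : Finset (B7Prop1Explicit.Site d × Fin d)) {L : ℕ} (hL : 1 ≤ L)
    {V₀ : B7Prop1Explicit.Site d → Fin d → 𝔸ˣ} (hV₀ : ∀ x κ, V₀ x κ ∈ U1 𝔸) {α : ℝ}
    (q : B7Prop1Explicit.Site d) (κ : Fin d) (hα1 : α ≤ 1 / 64)
    (hreg : ∀ r : Fin d → Fin L, ‖((Wcx L V₀ q κ (boxVec L r) : 𝔸ˣ) : 𝔸) - 1‖ ≤ α) (v : S → 𝔸) :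
    fderiv ℂ (fun a : S → 𝔸 => Qcov L V₀ (insCfg S a) q κ) 0 v = linQcov L V₀ (insCfg S v) q κ := by
  have hF : HasFDerivAt (fun a : S → 𝔸 => Qcov L V₀ (insCfg S a) q κ)
      (fderiv ℂ (fun a : S → 𝔸 => Qcov L V₀ (insCfg S a) q κ) 0) 0 :=
    (analyticOnNhd_chart S hL hV₀ q κ hα1 hreg 0 (mem_ball_self (c3_pos d hL))).differentiableAt.hasFDerivAt
  have hl : HasDerivAt (fun s : ℂ => s • v) ((1 : ℂ) • v) 0 := (hasDerivAt_id (0 : ℂ)).smul_const v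
  rw [one_smul] at hl
  have h := (hF.comp_hasDerivAt_of_eq (0 : ℂ) hl (by rw [zero_smul])).deriv
  rw [← h, linQcov]
  congr 1
  funext s
  simp only [Function.comp_apply, insCfg_smul]

/-- **PROP. 3 (123) ON THE POLYDISC — THE LANDAU CORRECTION AS A SECOND-ORDER REMAINDER**: the nonlinear part
`chart a − D(chart)(0) a` (row D4's `nonlin`) of the analytic chart obeys `‖·‖ ≤ (8 / c₃(d,L)²)·‖a‖²` on `‖a‖ < c₃(d, L)`
(several-variable Cauchy estimate with the sup bound `4`). [cite: Balaban1985Averaging, Proposition 3 (123) p.36] -/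
theorem norm_nonlin_chart_le (S : Finset (B7Prop1Explicit.Site d × Fin d)) {L : ℕ} (hL : 1 ≤ L)
    {V₀ : B7Prop1Explicit.Site d → Fin d → 𝔸ˣ} (hV₀ : ∀ x κ, V₀ x κ ∈ U1 𝔸) {α : ℝ}
    (q : B7Prop1Explicit.Site d) (κ : Fin d) (hα1 : α ≤ 1 / 64)
    (hreg : ∀ r : Fin d → Fin L, ‖((Wcx L V₀ q κ (boxVec L r) : 𝔸ˣ) : 𝔸) - 1‖ ≤ α) :
    ∀ a ∈ ball (0 : S → 𝔸) (c3 d L),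
      ‖nonlin (fun a : S → 𝔸 => Qcov L V₀ (insCfg S a) q κ) a‖ ≤ 8 / (c3 d L) ^ 2 * ‖a‖ ^ 2 := by
  intro a ha
  have h := nonlin_sq_bound (c3_pos d hL) (differentiableOn_chart S hL hV₀ q κ hα1 hreg)
    (norm_chart_le S hL hV₀ q κ hα1 hreg) (chart_zero S L V₀ q κ) a ha
  refine h.trans (le_of_eq ?_)
  ring

/-- … and that nonlinear part IS print's `C(V₀, insCfg S a, c)` (`B7Prop3GeneralLinear.Ccov`): `nonlin chart a
= Ccov L V₀ (insCfg S a) q κ`. [folklore] -/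
theorem nonlin_chart_eq_Ccov (S : Finset (B7Prop1Explicit.Site d × Fin d)) {L : ℕ} (hL : 1 ≤ L)
    {V₀ : B7Prop1Explicit.Site d → Fin d → 𝔸ˣ} (hV₀ : ∀ x κ, V₀ x κ ∈ U1 𝔸) {α : ℝ}
    (q : B7Prop1Explicit.Site d) (κ : Fin d) (hα1 : α ≤ 1 / 64)
    (hreg : ∀ r : Fin d → Fin L, ‖((Wcx L V₀ q κ (boxVec L r) : 𝔸ˣ) : 𝔸) - 1‖ ≤ α) (a : S → 𝔸) :
    nonlin (fun a : S → 𝔸 => Qcov L V₀ (insCfg S a) q κ) a = Ccov L V₀ (insCfg S a) q κ := by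
  rw [nonlin, Ccov, fderiv_chart_zero_apply S hL hV₀ q κ hα1 hreg a]

/-- **(122)–(123) ON THE POLYDISC, ASSEMBLED**: for `‖a‖ < c₃(d, L)`, `Q(V₀, insCfg S a, c) = L(Q(V₀)(insCfg S a))_c
+ C(V₀, insCfg S a, c)` with `‖C‖ ≤ (8 / c₃²)·‖a‖²`. [cite: Balaban1985Averaging, Proposition 3 (122)–(123) p.36] -/
theorem prop3_general_chart (S : Finset (B7Prop1Explicit.Site d × Fin d)) {L : ℕ} (hL : 1 ≤ L)
    {V₀ : B7Prop1Explicit.Site d → Fin d → 𝔸ˣ} (hV₀ : ∀ x κ, V₀ x κ ∈ U1 𝔸) {α : ℝ}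
    (q : B7Prop1Explicit.Site d) (κ : Fin d) (hα1 : α ≤ 1 / 64)
    (hreg : ∀ r : Fin d → Fin L, ‖((Wcx L V₀ q κ (boxVec L r) : 𝔸ˣ) : 𝔸) - 1‖ ≤ α) :
    ∀ a ∈ ball (0 : S → 𝔸) (c3 d L),
      Qcov L V₀ (insCfg S a) q κ = linQcov L V₀ (insCfg S a) q κ + Ccov L V₀ (insCfg S a) q κ ∧
        ‖Ccov L V₀ (insCfg S a) q κ‖ ≤ 8 / (c3 d L) ^ 2 * ‖a‖ ^ 2 := fun a ha =>
  ⟨Qcov_eq_linQcov_add_Ccov L V₀ _ q κ,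
    by rw [← nonlin_chart_eq_Ccov S hL hV₀ q κ hα1 hreg a]; exact norm_nonlin_chart_le S hL hV₀ q κ hα1 hreg a ha⟩

end Summit.QuantumFields.BalabanUV.T4Continuum.ShellMeasureAverageProp3Chart

end
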